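import Literature.NumberTheory.Rogawski1990.KottwitzSignDiagonalModel
import Literature.NumberTheory.Automorphic.UnitaryGroupBlockCentralizer
import Literature.NumberTheory.QuadraticForms.FiniteFieldHermitianCanonicalForm
import HarnessLib

/-!
# Kottwitz signs, V: the DIAGONAL FRAME of a split-singular element of `U(H)` — `γ P = P (a·1₂ ⊕ᶠ b·1₁)`, `ᵗ(σP) H P = diag(d₀, d₁, d₂)`
# (Rogawski 1990, §3.8 Prop. 3.8.1 (a) p. 30; Landherr 1936)

Topic `NumberTheory/Rogawski1990`; namespace `Literature.NumberTheory.Rogawski1990`.  THEOREMS ONLY (no definition, no named fact, no instance,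
no notation, no `sorry`).  Cell `pub/hodgecm-mathlib`, ENGINE T1 (crux H413 = `stmt-HodgeConjecture-24833`), row O7 «singular semisimple classes»,
«KOTTWITZ SIGNS» (F0P3a-plan RULING #116 (W19-1), O7 OWNER WORD #26 (1)); sequel of ★ `KottwitzSignDiagonalModel`.  HC_CM is proved only modulo
the printed citations until rung 0 closes; this file discharges none of them.

**`exists_diagonal_frame`** — over a field `K` with an involution `σ` and `1 + 1 ≠ 0`, for `H ∈ M₃(K)` hermitian non-degenerate and
`γ ∈ U(H)` killed by `(X − α)(X − β)` (`α ≠ β`, `γ ∉ {α·1, β·1}`) there are `a, b` (`{a,b} = {α,β}`, `σ(a)a = σ(b)b = 1`), a frame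
`P ∈ GL₃(K)` and `d : Fin 3 → K` with `σ dᵢ = dᵢ ≠ 0`, `ᵗ(σP) H P = diag(d)` and `γ P = P (a·1₂ ⊕ᶠ b·1₁)`: ★ `exists_singular_frame`
(`ᵗ(σP₀) H P₀ = H_a ⊕ᶠ H_b`) followed by a diagonalisation of the plane block `ᵗ(σQ) H_a Q = diag(d₀, d₁)` (★
`QuadraticForms.Hermitian.exists_congr_diagonal_of_involution`) spliced in as `P := P₀ (Q ⊕ᶠ 1)`, which commutes past `a·1₂ ⊕ᶠ b·1₁` (★
`finSum_commute_finSum_smul_one`).  With ★ `kottwitzSign_eq_of_frame` every Kottwitz sign of `γ` (at a finite place, at a complex place) is then a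
sign of the DIAGONAL MODEL (sequel `KottwitzSignPlaceReadings`).

## References
* [Rogawski1990] J. D. Rogawski, *Automorphic Representations of Unitary Groups in Three Variables*, Ann. of Math. Stud. 123 (1990), §3.8 Prop. 3.8.1
  (a) p. 30.
* [Landherr1936HermitianForms] W. Landherr, *Äquivalenz Hermitescher Formen über einem beliebigen algebraischen Zahlkörper*, Abh. Math. Sem. Hamburg 11
  (1936) 245–248.
-/

set_option autoImplicit false

noncomputable section

open Matrix
open scoped MatrixGroups

namespace Literature.NumberTheory.Rogawski1990

open Literature.NumberTheory.Automorphic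
open Literature.AlgebraicGeometry.ShimuraVarieties (unitaryGroup hermForm)
open Literature.NumberTheory.Automorphic.UnitaryGroup (finSum)


/-! ## §0 `⊕ᶠ` book-keeping -/

section FinSum

variable {S S' : Type*} [CommRing S] [CommRing S'] {N₁ N₂ : ℕ}

/-- `(A ⊕ᶠ B)(C ⊕ᶠ D) = AC ⊕ᶠ BD`. [folklore] -/
private theorem finSum_mul_finSum_eq (A C : Matrix (Fin N₁) (Fin N₁) S) (B D : Matrix (Fin N₂) (Fin N₂) S) :
    finSum N₁ N₂ A B * finSum N₁ N₂ C D = finSum N₁ N₂ (A * C) (B * D) := by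
  simp only [finSum, Matrix.reindex_apply, Matrix.submatrix_mul_equiv, Matrix.fromBlocks_multiply, Matrix.mul_zero, Matrix.zero_mul,
    add_zero, zero_add]

/-- `ᵗ((A ⊕ᶠ B).map f) = ᵗ(A.map f) ⊕ᶠ ᵗ(B.map f)`. [folklore] -/
private theorem transpose_map_finSum (f : S →+* S') (A : Matrix (Fin N₁) (Fin N₁) S) (B : Matrix (Fin N₂) (Fin N₂) S) :
    ((finSum N₁ N₂ A B).map f)ᵀ = finSum N₁ N₂ ((A.map f)ᵀ) ((B.map f)ᵀ) := by
  rw [UnitaryGroup.finSum_map, finSum, finSum, Matrix.transpose_reindex, Matrix.fromBlocks_transpose, Matrix.transpose_zero,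
    Matrix.transpose_zero]

/-- `det (A ⊕ᶠ B) = det A · det B`. [folklore] -/
private theorem det_finSum_eq (A : Matrix (Fin N₁) (Fin N₁) S) (B : Matrix (Fin N₂) (Fin N₂) S) : (finSum N₁ N₂ A B).det = A.det * B.det := by
  rw [finSum, Matrix.det_reindex_self, Matrix.det_fromBlocks_zero₂₁]

end FinSum

/-! ## §1 The diagonal frame of a rational split-singular element -/

section Frame

variable {K : Type*} [Field K] (σ : K →+* K)

/-- **THE DIAGONAL FRAME.**  Over a field `K` with an involution `σ` and `1 + 1 ≠ 0`: for `H ∈ M₃(K)` hermitian non-degenerate and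
`γ ∈ U(H)` killed by `(X − α)(X − β)`, `α ≠ β`, `γ ∉ {α·1, β·1}`, there are `a, b` (`{a,b} = {α,β}`, `σ(a)a = σ(b)b = 1`), a frame
`P ∈ GL₃(K)` and `d : Fin 3 → K` with `σ dᵢ = dᵢ ≠ 0`, `ᵗ(σP) H P = diag(d)` and `γ P = P (a·1₂ ⊕ᶠ b·1₁)` — ★ `exists_singular_frame`
(`ᵗ(σP₀) H P₀ = H_a ⊕ᶠ H_b`) followed by a diagonalisation `ᵗ(σQ) H_a Q = diag(d₀,d₁)` of the plane block (★
`Hermitian.exists_congr_diagonal_of_involution`) spliced in as `P := P₀ (Q ⊕ᶠ 1)`, which commutes past `a·1₂ ⊕ᶠ b·1₁`.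
[cite: Rogawski1990, §3.8 Prop. 3.8.1 (a) p. 30] [cite: Landherr1936HermitianForms] -/
theorem exists_diagonal_frame (hσ : ∀ x, σ (σ x) = x) (h2 : (1 : K) + 1 ≠ 0) (H : Matrix (Fin 3) (Fin 3) K) (hH : (H.map σ)ᵀ = H)
    (hdet : H.det ≠ 0) (γ : unitaryGroup σ H) {α β : K} (hαβ : α ≠ β)
    (hγ : (((γ : GL (Fin 3) K) : Matrix (Fin 3) (Fin 3) K) - α • 1) * (((γ : GL (Fin 3) K) : Matrix (Fin 3) (Fin 3) K) - β • 1) = 0)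
    (hα : ((γ : GL (Fin 3) K) : Matrix (Fin 3) (Fin 3) K) ≠ α • 1) (hβ : ((γ : GL (Fin 3) K) : Matrix (Fin 3) (Fin 3) K) ≠ β • 1) :
    ∃ (a b : K) (P : GL (Fin 3) K) (d : Fin 3 → K),
      ((a = α ∧ b = β) ∨ (a = β ∧ b = α)) ∧ σ a * a = 1 ∧ σ b * b = 1 ∧ (∀ i, σ (d i) = d i) ∧ (∀ i, d i ≠ 0) ∧
      (((P : Matrix (Fin 3) (Fin 3) K)).map σ)ᵀ * H * (P : Matrix (Fin 3) (Fin 3) K) = Matrix.diagonal d ∧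
      ((γ : GL (Fin 3) K) : Matrix (Fin 3) (Fin 3) K) * (P : Matrix (Fin 3) (Fin 3) K) =
        (P : Matrix (Fin 3) (Fin 3) K) * finSum 2 1 (a • (1 : Matrix (Fin 2) (Fin 2) K)) (b • (1 : Matrix (Fin 1) (Fin 1) K)) := by
  obtain ⟨a, b, P₀, Ha, Hb, hab, ha, hb, hP₀, hγP₀, hHa, hHb, hHad, hHbd⟩ := exists_singular_frame σ hσ H hH hdet γ hαβ hγ hα hβ
  -- diagonalise the plane block
  have hHa' : Haᵀ.map σ = Ha := by rw [Matrix.transpose_map]; exact hHa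
  obtain ⟨Q, hQ, da, hda, hda0, hQd⟩ :=
    QuadraticForms.Hermitian.exists_congr_diagonal_of_involution (σ := σ) hσ ⟨1, by rwa [map_one]⟩ Ha hHa' hHad
  -- the spliced frame `P := P₀ (Q ⊕ᶠ 1)`
  set Qm : Matrix (Fin 3) (Fin 3) K := finSum 2 1 Q (1 : Matrix (Fin 1) (Fin 1) K) with hQm
  have hQmdet : IsUnit Qm.det := by
    rw [hQm, det_finSum_eq, Matrix.det_one, mul_one]; exact hQ
  set Qu : GL (Fin 3) K := (Matrix.GeneralLinearGroup.mkOfDetNeZero Qm hQmdet.ne_zero) with hQu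
  have hQuval : (Qu : Matrix (Fin 3) (Fin 3) K) = Qm := rfl
  -- the entry of the line block
  have hb00 : σ (Hb 0 0) = Hb 0 0 := by
    have h := congrFun (congrFun hHb 0) 0
    simpa [Matrix.transpose_apply, Matrix.map_apply] using h
  have hb00ne : Hb 0 0 ≠ 0 := by rwa [Matrix.det_fin_one] at hHbd
  have hQd' : (Q.map σ)ᵀ * Ha * Q = Matrix.diagonal da := hQd
  have hHb1 : Hb = Matrix.diagonal ![Hb 0 0] := eq_diagonal_of_fin_one Hb
  refine ⟨a, b, P₀ * Qu, ![da 0, da 1, Hb 0 0], hab, ha, hb, ?_, ?_, ?_, ?_⟩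
  · intro i; fin_cases i
    · exact hda 0
    · exact hda 1
    · exact hb00
  · intro i; fin_cases i
    · exact hda0 0
    · exact hda0 1
    · exact hb00ne
  · -- the congruence
    rw [Units.val_mul, hQuval, Matrix.map_mul, Matrix.transpose_mul]
    calc (Qm.map σ)ᵀ * ((P₀ : Matrix (Fin 3) (Fin 3) K).map σ)ᵀ * H * ((P₀ : Matrix (Fin 3) (Fin 3) K) * Qm)
        = (Qm.map σ)ᵀ * ((((P₀ : Matrix (Fin 3) (Fin 3) K)).map σ)ᵀ * H * (P₀ : Matrix (Fin 3) (Fin 3) K)) * Qm := by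
          simp only [Matrix.mul_assoc]
      _ = Matrix.diagonal ![da 0, da 1, Hb 0 0] := by
          rw [hP₀, hQm, transpose_map_finSum, finSum_mul_finSum_eq, finSum_mul_finSum_eq, hQd',
            Matrix.map_one σ (map_zero σ) (map_one σ), Matrix.transpose_one, Matrix.one_mul, Matrix.mul_one]
          have hda' : Matrix.diagonal da = Matrix.diagonal ![da 0, da 1] := by
            congr 1; ext i; fin_cases i <;> rfl
          conv_lhs => rw [hHb1, hda']
          rw [finSum_diagonal_eq_diagonal]
  · -- the frame relation: `Q ⊕ᶠ 1` commutes with `a·1₂ ⊕ᶠ b·1₁`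
    rw [Units.val_mul, hQuval, ← Matrix.mul_assoc, hγP₀, Matrix.mul_assoc, Matrix.mul_assoc, hQm,
      UnitaryGroup.finSum_commute_finSum_smul_one]

end Frame

end Literature.NumberTheory.Rogawski1990

end
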